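import Summits.SmoothPoincare4.SmoothPoincare4.Theses.InformationMetricHadamard
import Literature.Geometry.Riemannian.CartanHadamardLift

/-!
# Stub `stub_normSubLeEdist` of line `core-distance-morse`
(crux `InformationMetricHadamard.C0AhRecognition`, stmt-SmoothPoincare4-6015)

**Calibration lemma.** Let `Φ : ℝ⁵ ≅ W` be a diffeomorphism onto a Riemannian `5`-manifold
`(W, G)` whose differential does not decrease lengths measured against the fixed positive definite
form `G_y` on `ℝ⁵ = T_yW`: `G_y(w, w) ≤ G_{Φ u}(dΦ_u w, dΦ_u w)`. Then
`|Φ⁻¹ p − Φ⁻¹ q|_{G_y} ≤ d_G(p, q)`.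

Proof. Put `w₀ = Φ⁻¹ p − Φ⁻¹ q` and consider the smooth function `F = G_y(w₀, Φ⁻¹ ·) : W → ℝ`.
By the chain rule `dF_x(v) = G_y(w₀, dΦ⁻¹_x v)`, and by Cauchy–Schwarz for `G_y` together with the
hypothesis applied to `u = Φ⁻¹ x`, `w = dΦ⁻¹_x v` (note `dΦ_u (dΦ⁻¹_x v) = v`),
`|dF_x(v)| ≤ |w₀|_{G_y} |v|_G`. Integrating along a `C¹` path `γ` from `p` to `q` (fundamental
theorem of calculus) gives `|w₀|²_{G_y} = |F q − F p| ≤ |w₀|_{G_y} · L(γ)`, whence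
`|w₀|_{G_y} ≤ L(γ)`; the infimum over `γ` is the claim.

* `mfderiv_apply_mfderiv_symm` — `dΦ ∘ dΦ⁻¹ = id`;
* `abs_val_mfderiv_symm_le` — the pointwise bound `|G_y(w₀, dΦ⁻¹_x v)| ≤ |w₀|_{G_y} ‖v‖`;
* `ofReal_sqrt_val_le_pathELength` — the bound along a `C¹` path;
* `stub_normSubLeEdist` — the registered stub.
Everything is proved (kind = proof); no definitions.
-/

noncomputable section

-- the prescribed namespace `Summit.<P>.<Sub>.…` duplicates `SmoothPoincare4` (P = Sub)
set_option linter.dupNamespace false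

open scoped Manifold ContDiff Topology ENNReal NNReal
open Set Function Bundle

namespace Summit.SmoothPoincare4.SmoothPoincare4.Cruxes.C0AhRecognition.CoreDistanceMorse

open Literature.Geometry.Lorentzian (PseudoRiemannianMetric)
open Literature.Geometry.Riemannian (abs_val_le_sqrt_mul_sqrt)

section Calibration

variable {W : Type} [TopologicalSpace W] [ChartedSpace (EuclideanSpace ℝ (Fin 5)) W]

/-- For a diffeomorphism `Φ : ℝ⁵ ≅ W`, `dΦ_{Φ⁻¹ x} ∘ d(Φ⁻¹)_x = id` on `T_xW` (chain rule for
`Φ ∘ Φ⁻¹ = id`). [folklore] -/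
theorem mfderiv_apply_mfderiv_symm (Φ : EuclideanSpace ℝ (Fin 5) ≃ₘ^∞⟮𝓡 5, 𝓡 5⟯ W) (x : W)
    (v : TangentSpace (𝓡 5) x) :
    mfderiv (𝓡 5) (𝓡 5) Φ (Φ.symm x) (mfderiv (𝓡 5) (𝓡 5) Φ.symm x v) = v := by
  -- adapted from Theorems/InformationMetricHadamardConvexEndRecognitionSphere (block `hΦΨ`)
  have hΦd : MDifferentiableAt (𝓡 5) (𝓡 5) Φ (Φ.symm x) :=
    Φ.contMDiff.mdifferentiableAt (by simp)
  have hΨd : MDifferentiableAt (𝓡 5) (𝓡 5) Φ.symm x :=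
    Φ.symm.contMDiff.mdifferentiableAt (by simp)
  have h := mfderiv_comp x hΦd hΨd
  have hid : (Φ : EuclideanSpace ℝ (Fin 5) → W) ∘ Φ.symm = id :=
    funext fun z ↦ Φ.apply_symm_apply z
  rw [hid, mfderiv_id] at h
  exact (congrArg (fun f ↦ f v) h).symm

variable [IsManifold (𝓡 5) ∞ W]
  (G : PseudoRiemannianMetric (𝓡 5) ∞ (EuclideanSpace ℝ (Fin 5))
    (TangentSpace (𝓡 5) : W → Type _))
  (hG : G.IsRiemannian) (y : W) (Φ : EuclideanSpace ℝ (Fin 5) ≃ₘ^∞⟮𝓡 5, 𝓡 5⟯ W)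
  (hΦ : ∀ u w : EuclideanSpace ℝ (Fin 5),
    G.val y w w ≤ G.val (Φ u) (mfderiv (𝓡 5) (𝓡 5) Φ u w) (mfderiv (𝓡 5) (𝓡 5) Φ u w))

include hG hΦ

/-- **Pointwise calibration bound.** If `dΦ` does not decrease `G_y`-lengths, then for every
`w₀ ∈ ℝ⁵`, `x ∈ W`, `v ∈ T_xW`: `|G_y(w₀, dΦ⁻¹_x v)| ≤ |w₀|_{G_y} ‖v‖_G` (Cauchy–Schwarz for the
positive definite `G_y`, then `|dΦ⁻¹_x v|_{G_y} ≤ |dΦ(dΦ⁻¹_x v)|_G = ‖v‖_G`). [folklore] -/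
theorem abs_val_mfderiv_symm_le (w₀ : EuclideanSpace ℝ (Fin 5)) (x : W)
    (v : TangentSpace (𝓡 5) x) :
    letI := G.riemannianBundle hG
    |G.val y w₀ (mfderiv (𝓡 5) (𝓡 5) Φ.symm x v)| ≤ Real.sqrt (G.val y w₀ w₀) * ‖v‖ := by
  letI := G.riemannianBundle hG
  have hpos : ∀ (z : W) (u : TangentSpace (𝓡 5) z), 0 ≤ G.val z u u := fun z u ↦ by
    by_cases h : u = 0
    · subst h; simp
    · exact (hG z u h).le
  set w : EuclideanSpace ℝ (Fin 5) := mfderiv (𝓡 5) (𝓡 5) Φ.symm x v with hw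
  -- the hypothesis at `u = Φ⁻¹ x`, `w = dΦ⁻¹_x v`, transported back to `x`
  have hle : G.val y w w ≤ G.val x v v := by
    have h := hΦ (Φ.symm x) w
    rw [hw, mfderiv_apply_mfderiv_symm Φ x v] at h
    rw [Φ.apply_symm_apply] at h
    exact h
  calc |G.val y w₀ w| ≤ Real.sqrt (G.val y w₀ w₀) * Real.sqrt (G.val y w w) :=
        abs_val_le_sqrt_mul_sqrt G hpos y w₀ w
    _ ≤ Real.sqrt (G.val y w₀ w₀) * Real.sqrt (G.val x v v) :=
        mul_le_mul_of_nonneg_left (Real.sqrt_le_sqrt hle) (Real.sqrt_nonneg _)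
    _ = Real.sqrt (G.val y w₀ w₀) * ‖v‖ := by rw [PseudoRiemannianMetric.norm_eq_sqrt G hG x v]

/-- **Calibration along a path.** If `dΦ` does not decrease `G_y`-lengths, then for every `C¹`
path `γ : ℝ → W`, `|Φ⁻¹(γ 0) − Φ⁻¹(γ 1)|_{G_y} ≤ L(γ|[0,1])`: with `w₀ = Φ⁻¹(γ 0) − Φ⁻¹(γ 1)` and
`F = G_y(w₀, Φ⁻¹ ·)`, the fundamental theorem of calculus and the pointwise bound give
`|w₀|²_{G_y} = |F(γ 1) − F(γ 0)| ≤ |w₀|_{G_y} L(γ)`. [folklore] -/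
theorem ofReal_sqrt_val_le_pathELength {γ : ℝ → W} (hγ : ContMDiff 𝓘(ℝ, ℝ) (𝓡 5) 1 γ) :
    letI := G.riemannianBundle hG
    ENNReal.ofReal (Real.sqrt (G.val y (Φ.symm (γ 0) - Φ.symm (γ 1))
        (Φ.symm (γ 0) - Φ.symm (γ 1)))) ≤ Manifold.pathELength (𝓡 5) γ 0 1 := by
  letI := G.riemannianBundle hG
  have hpos : ∀ (z : W) (u : TangentSpace (𝓡 5) z), 0 ≤ G.val z u u := fun z u ↦ by
    by_cases h : u = 0
    · subst h; simp
    · exact (hG z u h).le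
  set w₀ : EuclideanSpace ℝ (Fin 5) := Φ.symm (γ 0) - Φ.symm (γ 1) with hw₀
  -- the linear functional `G_y(w₀, ·)` on the model space and the test function `F`
  set ℓ : EuclideanSpace ℝ (Fin 5) →L[ℝ] ℝ := G.val y w₀ with hℓ
  set F : W → ℝ := (ℓ : EuclideanSpace ℝ (Fin 5) → ℝ) ∘ Φ.symm with hF
  have hFsm : ContMDiff (𝓡 5) 𝓘(ℝ, ℝ) ∞ F := ℓ.contMDiff.comp Φ.symm.contMDiff
  have hdF : ∀ (x : W) (v : TangentSpace (𝓡 5) x),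
      mfderiv (𝓡 5) 𝓘(ℝ, ℝ) F x v = G.val y w₀ (mfderiv (𝓡 5) (𝓡 5) Φ.symm x v) := by
    intro x v
    have hΨd : MDifferentiableAt (𝓡 5) (𝓡 5) Φ.symm x :=
      Φ.symm.contMDiff.mdifferentiableAt (by simp)
    have h := mfderiv_comp_apply x ℓ.mdifferentiableAt hΨd v
    rw [ContinuousLinearMap.mfderiv_eq] at h
    exact h
  -- `F ∘ γ` is `C¹`
  have hΛ : ContDiffOn ℝ 1 (F ∘ γ) (Icc 0 1) :=
    (contMDiff_iff_contDiff.1 ((hFsm.of_le (by exact_mod_cast le_top)).comp hγ)).contDiffOn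
  -- pointwise: `|(F ∘ γ)'| ≤ |w₀| ‖γ'‖`
  have h2 : ∀ r ∈ Icc (0 : ℝ) 1, ‖deriv (F ∘ γ) r‖ₑ ≤
      ENNReal.ofReal (Real.sqrt (G.val y w₀ w₀)) * ‖mfderiv 𝓘(ℝ, ℝ) (𝓡 5) γ r 1‖ₑ := by
    intro r _
    have hcomp : HasMFDerivAt 𝓘(ℝ, ℝ) 𝓘(ℝ, ℝ) (F ∘ γ) r
        ((mfderiv (𝓡 5) 𝓘(ℝ, ℝ) F (γ r)).comp (mfderiv 𝓘(ℝ, ℝ) (𝓡 5) γ r)) :=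
      ((hFsm (γ r)).mdifferentiableAt (by simp)).hasMFDerivAt.comp r
        ((hγ r).mdifferentiableAt one_ne_zero).hasMFDerivAt
    have e2 : fderiv ℝ (F ∘ γ) r = mfderiv 𝓘(ℝ, ℝ) 𝓘(ℝ, ℝ) (F ∘ γ) r :=
      (mfderiv_eq_fderiv (f := F ∘ γ) (x := r)).symm
    have hderiv : deriv (F ∘ γ) r =
        mfderiv (𝓡 5) 𝓘(ℝ, ℝ) F (γ r) (mfderiv 𝓘(ℝ, ℝ) (𝓡 5) γ r 1) := by
      rw [show deriv (F ∘ γ) r = fderiv ℝ (F ∘ γ) r 1 from rfl, e2, hcomp.mfderiv]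
      rfl
    have hb := abs_val_mfderiv_symm_le G hG y Φ hΦ w₀ (γ r) (mfderiv 𝓘(ℝ, ℝ) (𝓡 5) γ r 1)
    rw [← hdF, ← hderiv] at hb
    calc ‖deriv (F ∘ γ) r‖ₑ = ENNReal.ofReal |deriv (F ∘ γ) r| := Real.enorm_eq_ofReal_abs _
      _ ≤ ENNReal.ofReal (Real.sqrt (G.val y w₀ w₀) * ‖mfderiv 𝓘(ℝ, ℝ) (𝓡 5) γ r 1‖) :=
          ENNReal.ofReal_le_ofReal hb
      _ = ENNReal.ofReal (Real.sqrt (G.val y w₀ w₀)) * ‖mfderiv 𝓘(ℝ, ℝ) (𝓡 5) γ r 1‖ₑ := by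
          rw [ENNReal.ofReal_mul (Real.sqrt_nonneg _), ofReal_norm]
  -- integrate: `|w₀|² ≤ |w₀| · L(γ)`
  have hint : ENNReal.ofReal (G.val y w₀ w₀) ≤
      ENNReal.ofReal (Real.sqrt (G.val y w₀ w₀)) * Manifold.pathELength (𝓡 5) γ 0 1 := by
    calc ENNReal.ofReal (G.val y w₀ w₀) = ‖(F ∘ γ) 1 - (F ∘ γ) 0‖ₑ := by
          have h : (F ∘ γ) 1 - (F ∘ γ) 0 = -(G.val y w₀ w₀) := by
            show ℓ (Φ.symm (γ 1)) - ℓ (Φ.symm (γ 0)) = -(ℓ w₀)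
            rw [← map_sub, ← map_neg, hw₀, neg_sub]
          rw [h, enorm_neg, Real.enorm_eq_ofReal (hpos y w₀)]
      _ ≤ ∫⁻ r in Icc (0 : ℝ) 1, ‖deriv (F ∘ γ) r‖ₑ :=
          enorm_sub_le_lintegral_deriv_of_contDiffOn_Icc hΛ zero_le_one
      _ ≤ ∫⁻ r in Icc (0 : ℝ) 1,
            ENNReal.ofReal (Real.sqrt (G.val y w₀ w₀)) * ‖mfderiv 𝓘(ℝ, ℝ) (𝓡 5) γ r 1‖ₑ :=
          MeasureTheory.setLIntegral_mono' measurableSet_Icc h2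
      _ = ENNReal.ofReal (Real.sqrt (G.val y w₀ w₀)) *
            ∫⁻ r in Icc (0 : ℝ) 1, ‖mfderiv 𝓘(ℝ, ℝ) (𝓡 5) γ r 1‖ₑ :=
          MeasureTheory.lintegral_const_mul' _ _ ENNReal.ofReal_ne_top
      _ = ENNReal.ofReal (Real.sqrt (G.val y w₀ w₀)) * Manifold.pathELength (𝓡 5) γ 0 1 := by
          rw [← Manifold.pathELength_eq_lintegral_mfderiv_Icc]
  -- cancel `|w₀|`
  by_cases h0 : Real.sqrt (G.val y w₀ w₀) = 0
  · rw [h0, ENNReal.ofReal_zero]; exact bot_le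
  have hne : ENNReal.ofReal (Real.sqrt (G.val y w₀ w₀)) ≠ 0 :=
    (ENNReal.ofReal_pos.2 ((Real.sqrt_nonneg _).lt_of_ne (Ne.symm h0))).ne'
  have hsq : ENNReal.ofReal (G.val y w₀ w₀) =
      ENNReal.ofReal (Real.sqrt (G.val y w₀ w₀)) * ENNReal.ofReal (Real.sqrt (G.val y w₀ w₀)) := by
    rw [← ENNReal.ofReal_mul (Real.sqrt_nonneg _), Real.mul_self_sqrt (hpos y w₀)]
  rw [hsq] at hint
  exact (ENNReal.mul_le_mul_iff_right hne ENNReal.ofReal_ne_top).1 hint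

end Calibration

/-- **Stub L (`normSubLeEdist`, reshaped in by the lead, 2026-08-16).** Let `Φ : ℝ⁵ ≅ W` be a
diffeomorphism whose differential does not decrease lengths measured against the fixed positive
definite form `G_y` on `ℝ⁵ = T_yW`: `G_y(w, w) ≤ G_{Φ u}(dΦ_u w, dΦ_u w)` for all `u, w` (for
`Φ = exp_y` in a Cartan–Hadamard manifold this is stub R). Then `Φ⁻¹` is `1`-Lipschitz from
`(W, d_G)` to `(ℝ⁵, |·|_{G_y})`: `|Φ⁻¹ p − Φ⁻¹ q|_{G_y} ≤ d_G(p, q)`. Proof: for a `C¹` path `γ`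
from `p` to `q` (near-minimising, `exists_lt_locally_constant_of_riemannianEDist_lt`) the
calibration `F = G_y(w₀, Φ⁻¹ ·)`, `w₀ = Φ⁻¹ p − Φ⁻¹ q`, has `|dF(v)| ≤ |w₀|_{G_y} ‖v‖_G`
(Cauchy–Schwarz for `G_y` and `|dΦ⁻¹ v|_{G_y} ≤ ‖v‖_G`), so `|w₀|²_{G_y} = |F q − F p| ≤
|w₀|_{G_y} L(γ)`; take the infimum over `γ`. This is the CAT(0) comparison input of
Grove–Shiohama regularity. [cite: BridsonHaefliger1999, Ch. II.1, Prop. 1.4 (1) and II.4] -/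
theorem stub_normSubLeEdist
    (W : Type) [TopologicalSpace W] [T2Space W] [SecondCountableTopology W]
    [ChartedSpace (EuclideanSpace ℝ (Fin 5)) W] [IsManifold (𝓡 5) ∞ W]
    (G : PseudoRiemannianMetric (𝓡 5) ∞ (EuclideanSpace ℝ (Fin 5)) (TangentSpace (𝓡 5) : W → Type _))
    (hG : G.IsRiemannian) (y : W) (Φ : EuclideanSpace ℝ (Fin 5) ≃ₘ^∞⟮𝓡 5, 𝓡 5⟯ W)
    (hΦ : ∀ u w : EuclideanSpace ℝ (Fin 5),
      G.val y w w ≤ G.val (Φ u) (mfderiv (𝓡 5) (𝓡 5) Φ u w) (mfderiv (𝓡 5) (𝓡 5) Φ u w))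
    (p q : W) :
    ENNReal.ofReal (Real.sqrt (G.val y (Φ.symm p - Φ.symm q) (Φ.symm p - Φ.symm q))) ≤
      G.edist hG p q := by
  letI := G.riemannianBundle hG
  change _ ≤ Manifold.riemannianEDist (𝓡 5) p q
  refine le_of_forall_gt_imp_ge_of_dense fun r hr ↦ ?_
  obtain ⟨γ, hγ0, hγ1, hγsm, hγlen, -⟩ :=
    Manifold.exists_lt_locally_constant_of_riemannianEDist_lt hr zero_lt_one
  have h := ofReal_sqrt_val_le_pathELength G hG y Φ hΦ hγsm
  rw [hγ0, hγ1] at h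
  exact h.trans hγlen.le

end Summit.SmoothPoincare4.SmoothPoincare4.Cruxes.C0AhRecognition.CoreDistanceMorse

end
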